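import Summits.QuantumFields.YangMills.Theorems.BalabanUVNodesN16HolderRegime
import Summits.QuantumFields.YangMills.Theorems.BalabanUVNodesN16HolderOfLeaf
import Summits.QuantumFields.YangMills.Theorems.BalabanUVNodesN16LeafSlotRS
import HarnessLib

/-!
# Route «BalabanUVNodes», cluster K4 «SpineRates» — node N16 = NE3: THE RECORD-LEVEL β-KIT, LEAF FORM — the interface slot `LeafSlotHolder c β` (n16-e's
# `LeafSlot c` on N05's family `zdGF3 (M_N ℂ) c.L β len`), `LeafSlotHolder → PrintSlotHolder`, the one-application closers in N05's own currency at exponent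
# `β ∈ [0, 1]`, and N05's leaf of record SHAPE `B8LeafRS` ⟹ `LeafSlotHolder`

Cell `pub-ymgap`, seat `pub-ymgap-dag-n16-c` (R134 fan-out seat, strategy s1; HUMAN RULING D-0062; chair R424 venue), generation 3, file 16 — module (E2) of
the located item «the Hölder-exponent pin of N16's N05-socket» (`HOME/pub-ymgap-dag-n16-c/LOCATED-N16-HOLDER-PIN.md`; pub-ymgap INBOX DAGN16C-G3-INTENT-2);
over file 15 `…N16HolderRegime` (`PrintSlotHolder`, `InEndRegimeH`, closers), this seat's generation-0 `…N16OfLeaf` (`exists_window_print`,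
`thm4TorusAt_print_of_leaf {β} (0 ≤ β)`) ∕ `…N16Thm4TorusOfZd` (`thm4TorusAt_print_of_zd`) and n16-e's `…N16LeafSlot` ∕ `…N16LeafSlotRS` (p466652 ∕ p466939 —
MIRRORED at exponent `β`, NOT edited).  DEFINITION lane (1 `def` + bookkeeping; 0 sorry).  `--supports stmt-QuantumFields-19908` (helper).  `bears_on: R4∕N16 ·
edge N05 → N16`.

WHY.  n16-e's `LeafSlot c` puts N05's leaf conjuncts `B8.Thm4Body ∧ B8.Prop3Body` on the family `zdGF3 (M_N ℂ) c.L 1 len` — Hölder exponent `β₀ = 1`, which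
[Balaban1985RegularSpaces] excludes («β ≦ β₀ < 1», p. 82): the located pin, in N05's own currency.  THIS FILE is the same slot on `zdGF3 … c.L β len` for a
printed `β`, its passage to the print-form β-slot (`thm4TorusAt_print_of_leaf` + the periodicity principle, both β-generic), the closers
`InEndRegimeH c → LeafSlotHolder c β → N16HolderAt c β` (`0 ≤ β ≤ 1`), and the entry from node N05's leaf-of-record shape `B8LeafRS` on that family — so that under
R-β an instancer holding N05's record leaf AT ITS RESIDUAL EXPONENT and N07's interface meets N16's β-slot by one theorem.

WHAT THIS FILE DECLARES: §1 `LeafSlotHolder c β` · `leafSlotHolder_one_iff : LeafSlotHolder c 1 ↔ LeafSlot c`; §2 `printSlotHolder_of_leafSlotHolder` (`2 ≤ c.L`,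
`0 ≤ β`); §3 `n16HolderAt_of_inEndRegimeH_leafSlotHolder` (`0 ≤ β ≤ 1`) · `n16At_of_inEndRegimeH_leafSlot` (β = 1, the slot OF RECORD) ·
`s_N16Holder_of_inEndRegimeH_leafSlotHolder` · `s_N16_of_inEndRegimeH_leafSlot`; §4 `leafSlotHolder_of_b8LeafRS` (n16-e's `leafSlot_of_b8LeafRS` with `1 ↦ β`).
HONEST FRAMING: a definition and bookkeeping; `LeafSlotHolder` is a hypothesis SHAPE (node N05's [Balaban1985RegularSpaces] Thm 4 ∕ Prop 3 leaf as typed by n05-a,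
restricted to the all-torus sub-family, at a printed Hölder exponent; N07's [Balaban1985Variational] Thm 1 (8)+(10) TYPE) asserted for no bundle; nothing of
Bałaban's proved; **N16 ∕ NE3 NOT discharged**; the repair's statement edit is the planner's ∕ director's; count-neutral; one finite four-torus at fixed ε — NOT ℝ⁴,
NOT infinite volume, NOT OS, NOT a mass gap, NOT Clay.
-/

set_option autoImplicit false

open scoped BigOperators Matrix Matrix.Norms.L2Operator
open NormedSpace

namespace Summit.QuantumFields.YangMills.BalabanUVNodes.N16HolderLeafSlot

open Literature.MathematicalPhysics.QuantumFieldTheory.Balaban1983to89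
open Literature.MathematicalPhysics.QuantumFieldTheory.Balaban1983to89.T4Continuum (T4Family ULoop)
open B7Prop1Explicit B7Prop2Explicit
open B7Prop3Flat (c3)
open B7Eq92Concrete (mgauge)
open B8Ineq132 (covDerivFwd)
open B8Eq184Proof (cfgExp)
open B8Eq119TwistedAxial (Restr129)
open B8Eq133Hypotheses (Reg335Zd)
open B8Eq138LandauZd (IsLandau138 covLap)
open B8Thm4TorusAt (torusLam Thm4TorusAt)
open B8LeafModelZd (ZdIdx)
open B8LeafModelZd3 (zdGF3)
open B8LeafKnitRS (B8LeafRS)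
open Summit.QuantumFields.BalabanUV.T4Continuum
open T4AveragingDeficitWall (Ad)
open MinimalActionRate (sfClass)
open BlockAverageCurrent (curConst)
open NE3RightInverseSupLetters (frameC)
open NE3.LeafIndexSockets (LeafH3sup)
open YMDAG.UVSplit (Datum NE3Carriers RateCarriers RateRecordPred N16At S_N16)
open Summit.QuantumFields.YangMills.BalabanUVNodes.N16HolderDefs (N16HolderAt S_N16Holder n16HolderAt_one_iff)
open Summit.QuantumFields.YangMills.BalabanUVNodes.N16HolderRegime (PrintSlotHolder InEndRegimeH n16HolderAt_of_inEndRegimeH_printSlotHolder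
  printSlotHolder_one_iff)
open Summit.QuantumFields.YangMills.BalabanUVNodes.N16LeafSlot (LeafSlot)
open Summit.QuantumFields.YangMills.BalabanUVNodes.N16.OfLeaf (exists_window_print thm4TorusAt_print_of_leaf)
open Summit.QuantumFields.YangMills.BalabanUVNodes.N16 (thm4TorusAt_print_of_zd)

noncomputable section

/-! ## §1 The leaf-form interface slot at a bundle, on N05's family at Hölder exponent `β` -/

/-- **THE LEAF-FORM INTERFACE SLOT AT A BUNDLE `c : NE3Carriers N` ON `zdGF3 (M_N ℂ) c.L β len`** — n16-e's `N16LeafSlot.LeafSlot c` VERBATIM with the family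
`zdGF3 (Matrix (Fin N) (Fin N) ℂ) c.L 1 len` replaced by `zdGF3 … c.L β len` (Hölder exponent `β` in n05-a's `HolderDom` datum): for SOME length function and
letters as displayed, `B8.Thm4Body c₁ B₁′` AND `B8.Prop3Body cP 4 c.L C₂ inp B₀β` on `fun i : {i : ZdIdx 4 c.L // i.Ω 0 = univ} ↦ zdGF3 (M_N ℂ) c.L β len i.1`
([Balaban1985RegularSpaces] Thm 4 ∕ Prop 3 as typed by n05-a, all-torus sub-family, Hölder member at its PRINTED exponent «β ≦ β₀ < 1») AND N07's `LeafH3sup`.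
`LeafSlotHolder c 1 ↔ LeafSlot c` (below).  A hypothesis SHAPE — asserted for no bundle here. [cite: Balaban1985RegularSpaces, Thm 4 p.88, Prop. 3 p.87, (1.36) p.82] -/
@[folklore]
def LeafSlotHolder {N : ℕ} (c : NE3Carriers N) (β : ℝ) : Prop :=
  letI : CStarAlgebra (Matrix (Fin N) (Fin N) ℂ) := {}
  ∃ (len : Site 4 → ℝ) (c₁ c₁' B₁' cP C₂ B₀β : ℝ) (inp : B8.B9Inputs) (B Bh b' c' α Mc C335 : ℝ) (𝒬 : ℕ → Set (Set (Site 4) × ℕ)),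
    (∀ v : Site 4, 0 < len v → 1 ≤ len v) ∧ (∀ μ : Fin 4, len (e μ) = 1) ∧ 0 < B₁' ∧ 5 * ((4 : ℕ) : ℝ) * c.L * inp.B₀ ≤ B₁' ∧
    B = 5 * ((4 : ℕ) : ℝ) * c.L * inp.B₀ ∧ Bh = 5 * ((4 : ℕ) : ℝ) * c.L * B₀β ∧ 16 * (B * c₁') ≤ 1 ∧
    (∀ α₀ α₁ : ℝ, 0 < α₀ → 0 < α₁ → α₀ + α₁ ≤ c₁' →
      α₀ + α₁ ≤ c₁ ∧ C0 4 * (2 * α₀) ≤ 1 / 3 ∧ 4 * α₀ ≤ c2' 4 c.L ∧ 16 * (B₁' * (α₀ + α₁)) ≤ 1 ∧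
      Real.exp (4 * (800 * (((4 : ℕ) : ℝ) + 1) ^ 2 * (((4 : ℕ) : ℝ) + 4)) * α₀) * (1 + 8 * (131072 * (((4 : ℕ) : ℝ) + 1) ^ 2) * (B₁' * (α₀ + α₁))) ≤ 2 ∧
      2 * (B₁' * (α₀ + α₁)) ≤ c3 4 c.L ∧ ((4 : ℕ) : ℝ) * c.L * α₁ ≤ 1 / 8 ∧ α₀ ≤ cP ∧ α₁ ≤ cP ∧ B₁' * (α₀ + α₁) ≤ cP ∧
      2 * (B₁' * (α₀ + α₁)) ^ 2 + 20 * ((4 : ℕ) : ℝ) * α₀ * (B₁' * (α₀ + α₁)) + 2 * C₂ * (B₁' * (α₀ + α₁)) ^ 2 ≤ α₀ + α₁) ∧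
    0 ≤ b' ∧ 0 ≤ c' ∧ 2 ^ 15 * ((4 : ℝ) + 1) ^ 2 * ((4 : ℝ) + 4) ^ 2 * (c.L : ℝ) ^ 2 * b' ≤ 1 ∧
    23040 * (4 : ℝ) ^ 4 * (frameC 4 c.L + 4) ^ 3 * (c' + curConst 4 c.L * b' ^ 2) ≤ 1 ∧
    0 < α ∧ C0 4 * α ≤ 1 / 3 ∧ 2 * α ≤ c2' 4 c.L ∧ 11 * (4 : ℝ) ^ 2 * α ≤ 1 / 6 ∧ α + 11 * (4 : ℝ) ^ 2 * α ≤ c₁' ∧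
    (b' + 226 * (8 * ((4 : ℝ) + 1) * ((4 : ℝ) + 4)) ^ 2 * b' ^ 2) < α ∧ 4 * ((4 : ℝ) - 1) * (c' + curConst 4 c.L * b' ^ 2) < α ∧
    0 ≤ Mc ∧ (Mc + 1) * (b' + 226 * (8 * ((4 : ℝ) + 1) * ((4 : ℝ) + 4)) ^ 2 * b' ^ 2) ≤ 1 / 2 ∧
    (∀ k, ∀ q ∈ 𝒬 k, q.2 ≤ k ∧ ∃ y : Site 4, ∀ z ∈ q.1, (l1 (z - y) : ℝ) ≤ Mc * (c.L : ℝ) ^ q.2) ∧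
    2 * (Mc + 1) * (b' + 226 * (8 * ((4 : ℝ) + 1) * ((4 : ℝ) + 4)) ^ 2 * b' ^ 2) + 2 * Mc * (2 * (c' + curConst 4 c.L * b' ^ 2)) +
      4 * Mc * (1 + 2 * Mc) * (b' + 226 * (8 * ((4 : ℝ) + 1) * ((4 : ℝ) + 4)) ^ 2 * b' ^ 2) ^ 2 < C335 ∧
    c.ε < α ∧ B * (α + 11 * (4 : ℝ) ^ 2 * α) ≤ c.Λ₁ ∧
    B * (α + 11 * (4 : ℝ) ^ 2 * α) + 2 * (b' + 226 * (8 * ((4 : ℝ) + 1) * ((4 : ℝ) + 4)) ^ 2 * b' ^ 2) * c.Λ₁ ≤ c.Λ₁ ∧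
    B * (α + 11 * (4 : ℝ) ^ 2 * α) + 16 * (b' + 226 * (8 * ((4 : ℝ) + 1) * ((4 : ℝ) + 4)) ^ 2 * b' ^ 2) * (B * (α + 11 * (4 : ℝ) ^ 2 * α)) ≤ c.Λ₁ ∧
    Bh * (α + 11 * (4 : ℝ) ^ 2 * α) + 8 * (b' + 226 * (8 * ((4 : ℝ) + 1) * ((4 : ℝ) + 4)) ^ 2 * b' ^ 2) * (B * (α + 11 * (4 : ℝ) ^ 2 * α)) ≤ c.Λ₂' ∧
    B8.Thm4Body c₁ B₁' (fun i : {i : ZdIdx 4 c.L // i.Ω 0 = Set.univ} => (zdGF3 (Matrix (Fin N) (Fin N) ℂ) c.L β len i.1).toGFData) ∧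
    B8.Prop3Body cP 4 (c.L : ℝ) C₂ inp B₀β (fun i : {i : ZdIdx 4 c.L // i.Ω 0 = Set.univ} => (zdGF3 (Matrix (Fin N) (Fin N) ℂ) c.L β len i.1).toGFData2) ∧
    LeafH3sup 4 c.L c.Nper c.ε b' c' c.dom

/-- **AT `β = 1` THE LEAF β-SLOT IS n16-e's LEAF SLOT OF RECORD**: `LeafSlotHolder c 1 ↔ LeafSlot c` (`Iff.rfl`). [folklore] -/
theorem leafSlotHolder_one_iff {N : ℕ} (c : NE3Carriers N) : LeafSlotHolder c 1 ↔ LeafSlot c :=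
  Iff.rfl

/-! ## §2 The leaf-form β-slot implies the print-form β-slot -/

/-- **`LeafSlotHolder c β → PrintSlotHolder c β`** (`2 ≤ c.L`, `0 ≤ β`) — n16-e's `printSlot_of_leafSlot` with `1 ↦ β`: N05's leaf conjuncts on the univ sub-family
of `zdGF3 … c.L β len` + the window give Theorem 4 on the `ℤᵈ` carriers at every level `k ≥ 1` in N16's letters without periodicity, Hölder line at exponent `β`
(this seat's `N16.OfLeaf.thm4TorusAt_print_of_leaf {β} (0 ≤ β)`, `B = 5·4·L·B₀`, `B_h = 5·4·L·B₀β`), and the periodicity principle upgrades it to the all-torus geometry at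
period `c.Nper·c.Lᵏ` (`N16.thm4TorusAt_print_of_zd`, β-generic); the other conjuncts are carried verbatim with `c₁ := c₁′`. [folklore] -/
theorem printSlotHolder_of_leafSlotHolder {N : ℕ} [NeZero N] (c : NE3Carriers N) (hL : 2 ≤ c.L) {β : ℝ} (hβ : 0 ≤ β) (h : LeafSlotHolder c β) :
    PrintSlotHolder c β := by
  letI : CStarAlgebra (Matrix (Fin N) (Fin N) ℂ) := {}
  haveI : Nonempty (Fin N) := ⟨⟨0, Nat.pos_of_ne_zero (NeZero.ne N)⟩⟩
  obtain ⟨len, c₁, c₁', B₁', cP, C₂, B₀β, inp, B, Bh, b', c', α, Mc, C335, 𝒬, hlen, hlen1, hB₁', hBB, hBdef, hBhdef, hBc, hwin,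
    hb', hc', hRb, hcF, hα, hA3, hA2, hAs, hAc, hb'α, hc'α, hMc, hMcα, h𝒬, hC335, hεα, hss, hgrad, hℓ, hhol, hT, hP, h3⟩ := h
  have hL1 : 1 ≤ c.L := le_trans one_le_two hL
  have hB0 : 0 ≤ B := by rw [hBdef]; have := inp.B₀_pos.le; positivity
  -- N05's leaf at exponent `β` ⟹ Theorem 4 on the `ℤᵈ` carriers at every level (period `0`), in N16's letters with `B`, `B_h`
  have hzd := thm4TorusAt_print_of_leaf (d := 4) (n := Fin N) (by norm_num) hL hβ hlen hlen1 hB₁' hBB hwin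
    (fun k => Reg335Zd (((c.L : ℝ) ^ k)⁻¹) c.L (𝒬 k) C335) hT hP
  refine ⟨c₁', B, Bh, b', c', α, Mc, C335, 𝒬, hb', hc', hRb, hcF, hα, hA3, hA2, hAs, hAc, hb'α, hc'α, hMc, hMcα, h𝒬, hC335, hεα, hss, hgrad, hℓ,
    hhol, fun k hk => ?_, h3⟩
  have hη : 0 < ((c.L : ℝ) ^ k)⁻¹ := by
    have : (0 : ℝ) < c.L := by exact_mod_cast lt_of_lt_of_le one_pos hL1
    positivity
  have hη1 : ((c.L : ℝ) ^ k)⁻¹ ≤ 1 := inv_le_one_of_one_le₀ (one_le_pow₀ (by exact_mod_cast hL1))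
  have hk' := hzd k hk
  rw [← hBdef, ← hBhdef] at hk'
  exact thm4TorusAt_print_of_zd (d := 4) (n := Fin N) hL1 k c.Nper hη hη1 hB0 hBc _ hk'

/-! ## §3 The one-application closers in the leaf currency — at exponent `β ∈ [0, 1]`, and at the exponent of record -/

section Closers

variable {N : ℕ} [NeZero N]

/-- **THE ONE-APPLICATION CLOSER IN THE LEAF CURRENCY AT EXPONENT `β` — `InEndRegimeH c → LeafSlotHolder c β → N16HolderAt c β`** (`0 ≤ β ≤ 1`): a bundle in THE
END's β-uniform regime carrying the leaf-form β-slot satisfies the β-analogue of N16's record decl (§2 + file 15's `n16HolderAt_of_inEndRegimeH_printSlotHolder`;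
`2 ≤ c.L` is the proviso's first clause). [folklore] -/
theorem n16HolderAt_of_inEndRegimeH_leafSlotHolder {c : NE3Carriers N} (hreg : InEndRegimeH c) {β : ℝ} (hβ0 : 0 ≤ β) (hβ1 : β ≤ 1)
    (hslot : LeafSlotHolder c β) : N16HolderAt c β :=
  n16HolderAt_of_inEndRegimeH_printSlotHolder hreg hβ1 (printSlotHolder_of_leafSlotHolder c hreg.1 hβ0 hslot)

/-- **… AND AT THE EXPONENT OF RECORD — `InEndRegimeH c → LeafSlot c → N16At c`**: the β-uniform regime ALSO closes n16-e's leaf slot OF RECORD to N16's decl OF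
RECORD (`leafSlotHolder_one_iff`, `n16HolderAt_one_iff`). [folklore] -/
theorem n16At_of_inEndRegimeH_leafSlot {c : NE3Carriers N} (hreg : InEndRegimeH c) (hslot : LeafSlot c) : N16At c :=
  (n16HolderAt_one_iff c).mp (n16HolderAt_of_inEndRegimeH_leafSlotHolder hreg zero_le_one le_rfl ((leafSlotHolder_one_iff c).mpr hslot))

/-- **`S_N16Holder β RRec` FOR EVERY RATE-RECORD PREDICATE WHOSE BUNDLES ARE IN THE β-UNIFORM REGIME AND CARRY THE LEAF β-SLOT** (`0 ≤ β ≤ 1`; `RRec`-generic):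
the N05 in-edge consumed in N05's OWN typed currency at its residual exponent, N07's as `LeafH3sup`.  Neither is asserted here. [folklore] -/
theorem s_N16Holder_of_inEndRegimeH_leafSlotHolder (RRec : RateRecordPred N) {β : ℝ} (hβ0 : 0 ≤ β) (hβ1 : β ≤ 1)
    (h : ∀ (F : T4Family) (D : Datum F N) (g₀ : ℕ → ℝ) (os : List (ULoop F)) (R : RateCarriers N), RRec F D g₀ os R →
      InEndRegimeH R.ne3 ∧ LeafSlotHolder R.ne3 β) :
    S_N16Holder β RRec :=
  fun F D g₀ os R hR => n16HolderAt_of_inEndRegimeH_leafSlotHolder (h F D g₀ os R hR).1 hβ0 hβ1 (h F D g₀ os R hR).2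

/-- **`S_N16 RRec` (THE STUB OF RECORD) FROM THE β-UNIFORM REGIME AND THE LEAF SLOT OF RECORD** (`RRec`-generic). [folklore] -/
theorem s_N16_of_inEndRegimeH_leafSlot (RRec : RateRecordPred N)
    (h : ∀ (F : T4Family) (D : Datum F N) (g₀ : ℕ → ℝ) (os : List (ULoop F)) (R : RateCarriers N), RRec F D g₀ os R →
      InEndRegimeH R.ne3 ∧ LeafSlot R.ne3) :
    S_N16 RRec :=
  fun F D g₀ os R hR => n16At_of_inEndRegimeH_leafSlot (h F D g₀ os R hR).1 (h F D g₀ os R hR).2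

end Closers

/-! ## §4 From node N05's leaf of record SHAPE on `zdGF3 … c.L β len` to the leaf β-slot -/

/-- **FROM N05's LEAF OF RECORD AT ITS RESIDUAL EXPONENT TO THE LEAF β-SLOT** (`2 ≤ c.L`; any `β`) — n16-e's `N16LeafSlotRS.leafSlot_of_b8LeafRS` with `1 ↦ β`:
node N05's leaf shape `B8LeafRS 4 c.L C₂ B₁′ B₀′ B₁ B₂ c₁ inp B₀β loc fam lan cub toAxial` at `fam := fun i : {i : ZdIdx 4 c.L // i.Ω 0 = univ} ↦ zdGF3 (M_N ℂ) c.L β len i.1`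
(only `t4`, `p3` read), `len ≥ 1` on its support, `len e_μ = 1`, `0 < B₁′`, `5·4·c.L·B₀ ≤ B₁′`, YIELDS a window threshold `c₁′ > 0` with `16·(5·4·c.L·B₀·c₁′) ≤ 1`
(this seat's `exists_window_print`) such that for all leaf letters, averaging letter, (3.35) schedule on the slot's displayed lines at `c₁′` with `B := 5·4·c.L·B₀`,
`B_h := 5·4·c.L·B₀β`, N07's `LeafH3sup` gives `LeafSlotHolder c β`. [folklore] -/
theorem leafSlotHolder_of_b8LeafRS {N : ℕ} [NeZero N] (c : NE3Carriers N) (hL : 2 ≤ c.L) {β : ℝ} {I₁ I₃ I₄ : Type} {C₂ B₁' B₀' B₁ B₂ c₁ : ℝ} {inp : B8.B9Inputs}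
    {B₀β : ℝ} {loc : I₁ → B8.LocalData} {lan : I₃ → B8.LandauData} {cub : I₄ → B8.CubeData} {len : Site 4 → ℝ}
    {toAxial : letI : CStarAlgebra (Matrix (Fin N) (Fin N) ℂ) := {}
      ∀ i : {i : ZdIdx 4 c.L // i.Ω 0 = Set.univ},
        (zdGF3 (Matrix (Fin N) (Fin N) ℂ) c.L β len i.1).Cfg → (zdGF3 (Matrix (Fin N) (Fin N) ℂ) c.L β len i.1).Pert →
          (zdGF3 (Matrix (Fin N) (Fin N) ℂ) c.L β len i.1).Pert}
    (hlen : ∀ v : Site 4, 0 < len v → 1 ≤ len v) (hlen1 : ∀ μ : Fin 4, len (e μ) = 1) (hB₁' : 0 < B₁')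
    (hBB : 5 * ((4 : ℕ) : ℝ) * c.L * inp.B₀ ≤ B₁')
    (leaf : letI : CStarAlgebra (Matrix (Fin N) (Fin N) ℂ) := {}
      B8LeafRS 4 (c.L : ℝ) C₂ B₁' B₀' B₁ B₂ c₁ inp B₀β loc
        (fun i : {i : ZdIdx 4 c.L // i.Ω 0 = Set.univ} => zdGF3 (Matrix (Fin N) (Fin N) ℂ) c.L β len i.1) lan cub toAxial) :
    ∃ c₁' : ℝ, 0 < c₁' ∧ 16 * (5 * ((4 : ℕ) : ℝ) * c.L * inp.B₀ * c₁') ≤ 1 ∧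
      ∀ ⦃b' c' : ℝ⦄, 0 ≤ b' → 0 ≤ c' →
      2 ^ 15 * ((4 : ℝ) + 1) ^ 2 * ((4 : ℝ) + 4) ^ 2 * (c.L : ℝ) ^ 2 * b' ≤ 1 →
      23040 * (4 : ℝ) ^ 4 * (frameC 4 c.L + 4) ^ 3 * (c' + curConst 4 c.L * b' ^ 2) ≤ 1 →
      ∀ ⦃α : ℝ⦄, 0 < α → C0 4 * α ≤ 1 / 3 → 2 * α ≤ c2' 4 c.L → 11 * (4 : ℝ) ^ 2 * α ≤ 1 / 6 → α + 11 * (4 : ℝ) ^ 2 * α ≤ c₁' →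
      b' + 226 * (8 * ((4 : ℝ) + 1) * ((4 : ℝ) + 4)) ^ 2 * b' ^ 2 < α → 4 * ((4 : ℝ) - 1) * (c' + curConst 4 c.L * b' ^ 2) < α →
      ∀ ⦃Mc : ℝ⦄, 0 ≤ Mc → (Mc + 1) * (b' + 226 * (8 * ((4 : ℝ) + 1) * ((4 : ℝ) + 4)) ^ 2 * b' ^ 2) ≤ 1 / 2 →
      ∀ (𝒬 : ℕ → Set (Set (Site 4) × ℕ)), (∀ k, ∀ q ∈ 𝒬 k, q.2 ≤ k ∧ ∃ y : Site 4, ∀ z ∈ q.1, (l1 (z - y) : ℝ) ≤ Mc * (c.L : ℝ) ^ q.2) →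
      ∀ ⦃C335 : ℝ⦄, 2 * (Mc + 1) * (b' + 226 * (8 * ((4 : ℝ) + 1) * ((4 : ℝ) + 4)) ^ 2 * b' ^ 2) + 2 * Mc * (2 * (c' + curConst 4 c.L * b' ^ 2)) +
        4 * Mc * (1 + 2 * Mc) * (b' + 226 * (8 * ((4 : ℝ) + 1) * ((4 : ℝ) + 4)) ^ 2 * b' ^ 2) ^ 2 < C335 →
      c.ε < α → 5 * ((4 : ℕ) : ℝ) * c.L * inp.B₀ * (α + 11 * (4 : ℝ) ^ 2 * α) ≤ c.Λ₁ →
      5 * ((4 : ℕ) : ℝ) * c.L * inp.B₀ * (α + 11 * (4 : ℝ) ^ 2 * α) +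
          2 * (b' + 226 * (8 * ((4 : ℝ) + 1) * ((4 : ℝ) + 4)) ^ 2 * b' ^ 2) * c.Λ₁ ≤ c.Λ₁ →
      5 * ((4 : ℕ) : ℝ) * c.L * inp.B₀ * (α + 11 * (4 : ℝ) ^ 2 * α) + 16 * (b' + 226 * (8 * ((4 : ℝ) + 1) * ((4 : ℝ) + 4)) ^ 2 * b' ^ 2) *
          (5 * ((4 : ℕ) : ℝ) * c.L * inp.B₀ * (α + 11 * (4 : ℝ) ^ 2 * α)) ≤ c.Λ₁ →
      5 * ((4 : ℕ) : ℝ) * c.L * B₀β * (α + 11 * (4 : ℝ) ^ 2 * α) + 8 * (b' + 226 * (8 * ((4 : ℝ) + 1) * ((4 : ℝ) + 4)) ^ 2 * b' ^ 2) *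
          (5 * ((4 : ℕ) : ℝ) * c.L * inp.B₀ * (α + 11 * (4 : ℝ) ^ 2 * α)) ≤ c.Λ₂' →
      LeafH3sup 4 c.L c.Nper c.ε b' c' c.dom → LeafSlotHolder c β := by
  letI : CStarAlgebra (Matrix (Fin N) (Fin N) ℂ) := {}
  -- the two thresholds of the leaf's `t4` ∕ `p3`, and the window threshold below them
  obtain ⟨c₁t, hc₁t, hT⟩ := leaf.t4
  obtain ⟨cP, hcP, hP⟩ := leaf.p3
  obtain ⟨c₁', hc₁', hwin⟩ := exists_window_print (d := 4) (L := c.L) (by norm_num) hL C₂ hc₁t hcP hB₁'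
  have h16 : 16 * (5 * ((4 : ℕ) : ℝ) * c.L * inp.B₀ * c₁') ≤ 1 := by
    obtain ⟨-, -, -, h, -⟩ := hwin (c₁' / 2) (c₁' / 2) (by linarith) (by linarith) (by linarith)
    have h' : 16 * (B₁' * c₁') ≤ 1 := by rwa [add_halves] at h
    nlinarith [mul_le_mul_of_nonneg_right hBB hc₁'.le]
  refine ⟨c₁', hc₁', h16, fun b' c' hb' hc' hRb hcF α hα hA3 hA2 hAs hAc hb'α hc'α Mc hMc hMcα 𝒬 h𝒬 C335 hC335 hεα hss hgrad hℓ hhol h3 => ?_⟩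
  exact ⟨len, c₁t, c₁', B₁', cP, C₂, B₀β, inp, 5 * ((4 : ℕ) : ℝ) * c.L * inp.B₀, 5 * ((4 : ℕ) : ℝ) * c.L * B₀β, b', c', α, Mc, C335, 𝒬, hlen, hlen1,
    hB₁', hBB, rfl, rfl, by linarith [h16], hwin, hb', hc', hRb, hcF, hα, hA3, hA2, hAs, hAc, hb'α, hc'α, hMc, hMcα, h𝒬, hC335, hεα, hss, hgrad, hℓ,
    hhol, hT, hP, h3⟩

end

end Summit.QuantumFields.YangMills.BalabanUVNodes.N16HolderLeafSlot
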